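import Literature.Geometry.Riemannian.TwistorFrames
import Mathlib.Geometry.Manifold.VectorBundle.Basic
import HarnessLib

/-!
# The twistor bundle of an oriented Riemannian 4-manifold as a smooth 6-manifold
(topic `Geometry/Riemannian`; support for `exists_twistorSpace`, `TwistorPackage.lean`)

For a Riemannian metric `g` (`g.IsRiemannian`) and a smooth orientation `o` on a smooth
4-manifold `M` we construct the total space `Z = S(Λ⁺M)` of the twistor fibration as a
`FiberBundleCore` over `M` with fibre the round 2-sphere `S² ⊂ ℝ³` (Atiyah–Hitchin–Singer 1978,
§4; Besse 1987, 13.44): the index set is the type of twistor frames (`TwistorFrame g o`: smooth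
positive `g`-orthonormal frame fields `e` on open sets `U`), a point of `Z` over `x` read in the
frame `e` is `ζ ∈ S²` standing for the complex structure `J_ζ(e(x))` of `T_x M`, and the
coordinate changes are the maps `ζ ↦ T(x) ζ` of `TwistorFrameChange.lean`
(`frameTransition ∈ SO(3)`, smooth in `x`). We prove that `Z` is a Hausdorff, second countable
`C^∞` manifold modelled on `ℝ⁶` (`twistorTotal.instIsManifold`): its charts are
"local trivialisation, then a chart of `M × S²`, then `ℝ⁴ × ℝ² ≅ ℝ⁶`", and the chart changes are
smooth because the transition maps `(x, ζ) ↦ (x, T(x) ζ)` are smooth self-maps of open subsets of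
the product manifold `M × S²` (`contMDiffOn_trivChange`).

Everything here is proved; no named facts are introduced.

## References

* M. F. Atiyah, N. J. Hitchin, I. M. Singer, *Self-duality in four-dimensional Riemannian
  geometry*, Proc. R. Soc. A 362 (1978), §4. [AtiyahHitchinSinger1978]
* A. L. Besse, *Einstein Manifolds* (1987), 13.44–13.45. [Besse1987]
-/

noncomputable section

open scoped Manifold ContDiff Matrix BigOperators Topology
open Bundle Set Filter Module Function

namespace Literature.Geometry.Riemannian

open Literature.Geometry.Lorentzian (PseudoRiemannianMetric)
open Literature.Geometry.Lorentzian.PseudoRiemannianMetric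
open Literature.Topology.FourManifolds (SmoothOrientation)
open Literature.Topology.FourManifolds

/-- Local notation: the model space `ℝ⁴`. -/
local notation "E4" => EuclideanSpace ℝ (Fin 4)
/-- Local notation: `ℝ³`, the ambient space of the fibre sphere. -/
local notation "E3" => EuclideanSpace ℝ (Fin 3)
/-- Local notation: `ℝ²`, the model of the fibre sphere. -/
local notation "E2" => EuclideanSpace ℝ (Fin 2)
/-- Local notation: `ℝ⁶`, the model of the total space. -/
local notation "E6" => EuclideanSpace ℝ (Fin 6)
/-- Local notation: the unit 2-sphere in `ℝ³`, with its analytic manifold structure `𝓡 2`. -/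
local notation "𝕊²" => (Metric.sphere (0 : EuclideanSpace ℝ (Fin 3)) 1)

variable {M : Type*} [TopologicalSpace M] [ChartedSpace (EuclideanSpace ℝ (Fin 4)) M]
  [IsManifold (𝓡 4) ∞ M]
  (g : PseudoRiemannianMetric (𝓡 4) ∞ E4 (TangentSpace (𝓡 4) : M → Type _))
  (hg : g.IsRiemannian) (o : SmoothOrientation (𝓡 4) M)

/-! ### The coordinate changes -/

/-- Instance: `dim ℝ³ = 2 + 1`, making the manifold structure `𝓡 2` of `𝕊²` available. [folklore] -/
instance instFactFinrankThree : Fact (finrank ℝ E3 = 2 + 1) := ⟨finrank_euclideanSpace_fin⟩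

variable {g o} in
/-- **The coordinate change of the twistor bundle** from the frame `F` to the frame `F'` over
`x`: `ζ ↦ T(x) ζ` with `T(x) = frameTransition g x (e'(x)) (e(x))`, so that
`J_ζ(e(x)) = J_{T(x)ζ}(e'(x))` (`TwistorFrame.frameComplexStructure_eq`); a self-map of the unit
sphere for `x ∈ U ∩ U'` (`TwistorFrame.norm_frameTransition`), the identity (junk) elsewhere.
[cite: AtiyahHitchinSinger1978, §4] -/
def twistorCoordChange (F F' : TwistorFrame g o) (x : M) (ζ : 𝕊²) : 𝕊² :=
  haveI := Classical.dec (x ∈ F.U ∧ x ∈ F'.U)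
  if h : x ∈ F.U ∧ x ∈ F'.U then
    ⟨WithLp.toLp 2 (frameTransition g x (F'.fr x) (F.fr x) (WithLp.ofLp (ζ : E3))), by
      rw [mem_sphere_zero_iff_norm, F'.norm_frameTransition F h.2 h.1, norm_eq_of_mem_sphere ζ]⟩
  else ζ

variable {g o} in
/-- The coordinate change on `U ∩ U'`, as a vector of `ℝ³`. [folklore] -/
theorem coe_twistorCoordChange {F F' : TwistorFrame g o} {x : M} (hx : x ∈ F.U) (hx' : x ∈ F'.U)
    (ζ : 𝕊²) :
    ((twistorCoordChange F F' x ζ : 𝕊²) : E3) =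
      WithLp.toLp 2 (frameTransition g x (F'.fr x) (F.fr x) (WithLp.ofLp (ζ : E3))) := by
  rw [twistorCoordChange, dif_pos ⟨hx, hx'⟩]

variable {g o} in
/-- The coordinate change of a frame with itself is the identity. [folklore] -/
theorem twistorCoordChange_self (F : TwistorFrame g o) {x : M} (hx : x ∈ F.U) (ζ : 𝕊²) :
    twistorCoordChange F F x ζ = ζ := by
  ext1
  rw [coe_twistorCoordChange hx hx, F.frameTransition_self hx]

variable {g o} in
/-- **Cocycle identity** of the coordinate changes. [cite: AtiyahHitchinSinger1978, §4] -/
theorem twistorCoordChange_comp (F F' F'' : TwistorFrame g o) {x : M} (hx : x ∈ F.U)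
    (hx' : x ∈ F'.U) (hx'' : x ∈ F''.U) (ζ : 𝕊²) :
    twistorCoordChange F' F'' x (twistorCoordChange F F' x ζ) = twistorCoordChange F F'' x ζ := by
  ext1
  rw [coe_twistorCoordChange hx' hx'', coe_twistorCoordChange hx hx',
    coe_twistorCoordChange hx hx'', WithLp.ofLp_toLp,
    F''.frameTransition_frameTransition F' F hx'' hx' hx]

variable {g o} in
/-- The coordinate change read in `ℝ³`, as a globally defined map on `M × S²` (the formula of
`twistorCoordChange` without the membership guard). [folklore] -/
def twistorCoordChangeVec (F F' : TwistorFrame g o) (p : M × 𝕊²) : E3 :=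
  WithLp.toLp 2 (frameTransition g p.1 (F'.fr p.1) (F.fr p.1) (WithLp.ofLp (p.2 : E3)))

variable {g o} in
/-- **The coordinate change is smooth in `(x, ζ)`** as an `ℝ³`-valued map on `(U ∩ U') × S²`
(a polynomial in the pairings of the two frame fields, `TwistorFrame.frameTransition_apply_eq`,
and in the coordinates of `ζ`). [folklore] -/
theorem contMDiffOn_twistorCoordChangeVec (F F' : TwistorFrame g o) :
    ContMDiffOn ((𝓡 4).prod (𝓡 2)) 𝓘(ℝ, E3) ∞ (twistorCoordChangeVec F F')
      (((F.U : Set M) ∩ F'.U) ×ˢ (univ : Set 𝕊²)) := by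
  -- coordinates of `ζ` are smooth
  have hζ : ∀ i : Fin 3, ContMDiff ((𝓡 4).prod (𝓡 2)) 𝓘(ℝ, ℝ) ∞
      (fun p : M × 𝕊² ↦ (WithLp.ofLp (p.2 : E3)) i) := fun i ↦ by
    have h1 : ContMDiff (𝓡 2) 𝓘(ℝ, E3) ∞ (fun ζ : 𝕊² ↦ (ζ : E3)) := contMDiff_coe_sphere
    have h2 : ContMDiff 𝓘(ℝ, E3) 𝓘(ℝ, ℝ) ∞ (⇑(EuclideanSpace.proj i : E3 →L[ℝ] ℝ)) :=
      (EuclideanSpace.proj i : E3 →L[ℝ] ℝ).contDiff.contMDiff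
    exact (h2.comp h1).comp contMDiff_snd
  -- pairings of the frames, pulled back along `fst`
  have hval : ∀ p c : Fin 4, ContMDiffOn ((𝓡 4).prod (𝓡 2)) 𝓘(ℝ, ℝ) ∞
      (fun q : M × 𝕊² ↦ g.val q.1 (F.frame p q.1) (F'.frame c q.1))
      (((F.U : Set M) ∩ F'.U) ×ˢ (univ : Set 𝕊²)) := fun p c ↦ by
    have h := F'.contMDiffOn_val_frame F p c
    have h' : ContMDiffOn ((𝓡 4).prod (𝓡 2)) 𝓘(ℝ, ℝ) ∞
        ((fun x ↦ g.val x (F.frame p x) (F'.frame c x)) ∘ Prod.fst)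
        (((F.U : Set M) ∩ F'.U) ×ˢ (univ : Set 𝕊²)) :=
      h.comp contMDiffOn_fst fun q hq ↦ ⟨hq.1.2, hq.1.1⟩
    exact h'
  -- the map into `Fin 3 → ℝ` is smooth, componentwise
  have hcomp : ContMDiffOn ((𝓡 4).prod (𝓡 2)) 𝓘(ℝ, Fin 3 → ℝ) ∞
      (fun p : M × 𝕊² ↦ frameTransition g p.1 (F'.fr p.1) (F.fr p.1) (WithLp.ofLp (p.2 : E3)))
      (((F.U : Set M) ∩ F'.U) ×ˢ (univ : Set 𝕊²)) := by
    rw [contMDiffOn_pi_space]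
    intro m
    have heq : (fun p : M × 𝕊² ↦
        frameTransition g p.1 (F'.fr p.1) (F.fr p.1) (WithLp.ofLp (p.2 : E3)) m) =
        fun p ↦ ∑ i, (WithLp.ofLp (p.2 : E3)) i * ∑ k,
          (g.val p.1 (F.frame (selfDualIdx i k).1 p.1) (F'.frame 0 p.1) *
              g.val p.1 (F.frame (selfDualIdx i k).2 p.1) (F'.frame m.succ p.1) -
            g.val p.1 (F.frame (selfDualIdx i k).2 p.1) (F'.frame 0 p.1) *
              g.val p.1 (F.frame (selfDualIdx i k).1 p.1) (F'.frame m.succ p.1)) :=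
      funext fun p ↦ F'.frameTransition_apply_eq F p.1 _ m
    rw [heq]
    refine contMDiffOn_finsetSum fun i _ ↦ (hζ i).contMDiffOn.mul (contMDiffOn_finsetSum fun k _ ↦ ?_)
    exact ((hval _ _).mul (hval _ _)).sub ((hval _ _).mul (hval _ _))
  have hL : ContMDiff 𝓘(ℝ, Fin 3 → ℝ) 𝓘(ℝ, E3) ∞ (fun v : Fin 3 → ℝ ↦ WithLp.toLp 2 v) :=
    (EuclideanSpace.equiv (Fin 3) ℝ).symm.contDiff.contMDiff
  exact hL.comp_contMDiffOn hcomp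

variable {g o} in
/-- The coordinate change is continuous on `(U ∩ U') × S²`. [folklore] -/
theorem continuousOn_twistorCoordChange (F F' : TwistorFrame g o) :
    ContinuousOn (fun p : M × 𝕊² ↦ twistorCoordChange F F' p.1 p.2)
      (((F.U : Set M) ∩ F'.U) ×ˢ (univ : Set 𝕊²)) := by
  rw [Topology.IsInducing.subtypeVal.continuousOn_iff]
  refine (contMDiffOn_twistorCoordChangeVec F F').continuousOn.congr fun p hp ↦ ?_
  exact coe_twistorCoordChange hp.1.1 hp.1.2 p.2

/-! ### The fibre bundle core and the total space -/

/-- A twistor frame around each point (a choice, `exists_twistorFrame`). [folklore] -/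
def twistorFrameAt (x : M) : TwistorFrame g o :=
  (exists_twistorFrame g hg o x).choose

/-- The chosen frame at `x` is defined around `x`. [folklore] -/
theorem mem_twistorFrameAt (x : M) : x ∈ (twistorFrameAt g hg o x).U :=
  (exists_twistorFrame g hg o x).choose_spec

/-- **The twistor bundle as a fibre bundle core**: base `M`, fibre `S²`, index set the twistor
frames, coordinate changes `twistorCoordChange` (Atiyah–Hitchin–Singer 1978, §4: the sphere
bundle of `Λ⁺`, trivialised by positive orthonormal frames; structure group `SO(3)`).
[cite: AtiyahHitchinSinger1978, §4] -/
def twistorCore : FiberBundleCore (TwistorFrame g o) M 𝕊² where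
  baseSet F := F.U
  isOpen_baseSet F := F.U.isOpen
  indexAt := twistorFrameAt g hg o
  mem_baseSet_at := mem_twistorFrameAt g hg o
  coordChange := twistorCoordChange
  coordChange_self F _ hx ζ := twistorCoordChange_self F hx ζ
  continuousOn_coordChange F F' := continuousOn_twistorCoordChange F F'
  coordChange_comp F F' F'' _ hx ζ := twistorCoordChange_comp F F' F'' hx.1.1 hx.1.2 hx.2 ζ

/-- The base sets of the twistor bundle core are the domains of the frames. [folklore] -/
@[simp] theorem twistorCore_baseSet (F : TwistorFrame g o) : (twistorCore g hg o).baseSet F = F.U :=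
  rfl

/-- The coordinate changes of the twistor bundle core. [folklore] -/
@[simp] theorem twistorCore_coordChange (F F' : TwistorFrame g o) :
    (twistorCore g hg o).coordChange F F' = twistorCoordChange F F' :=
  rfl

/-- The base set of a local trivialisation of the twistor bundle core. [folklore] -/
@[simp] theorem twistorCore_localTriv_baseSet (F : TwistorFrame g o) :
    ((twistorCore g hg o).localTriv F).baseSet = F.U :=
  rfl

/-- **The total space of the twistor bundle** `Z = S(Λ⁺M)` (as a type: pairs `⟨x, ζ⟩`, `ζ` read
in the chosen frame at `x`). [cite: AtiyahHitchinSinger1978, §4] -/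
abbrev twistorTotal : Type _ := (twistorCore g hg o).TotalSpace

/-- The bundle projection of the twistor bundle. [cite: AtiyahHitchinSinger1978, §4] -/
abbrev twistorProj : twistorTotal g hg o → M := Bundle.TotalSpace.proj

/-! ### Topology: Hausdorff and second countable -/

/-- The total space of the twistor bundle is Hausdorff (points in different fibres are separated
by `π`, points in one fibre by a local trivialisation). [folklore] -/
instance twistorTotal.instT2Space [T2Space M] : T2Space (twistorTotal g hg o) := by
  classical
  set Z := twistorCore g hg o with hZ
  refine (t2Space_iff _).2 fun z z' hne ↦ ?_
  by_cases hp : z.proj = z'.proj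
  · set e := Z.localTrivAt z.proj with he
    have hz : z ∈ e.source := (Z.mem_localTrivAt_source z z.proj).2 (Z.mem_baseSet_at z.proj)
    have hz' : z' ∈ e.source := by
      rw [he, FiberBundleCore.mem_localTrivAt_source, ← hp]
      exact Z.mem_baseSet_at z.proj
    have hne' : e z ≠ e z' := fun h ↦ hne (e.injOn hz hz' h)
    obtain ⟨a, b, ha, hb, hza, hzb, hab⟩ := t2_separation hne'
    refine ⟨e.source ∩ e ⁻¹' a, e.source ∩ e ⁻¹' b,
      e.toOpenPartialHomeomorph.isOpen_inter_preimage ha,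
      e.toOpenPartialHomeomorph.isOpen_inter_preimage hb, ⟨hz, hza⟩, ⟨hz', hzb⟩, ?_⟩
    exact Set.disjoint_left.2 fun w hw hw' ↦ Set.disjoint_left.1 hab hw.2 hw'.2
  · obtain ⟨a, b, ha, hb, hza, hzb, hab⟩ := t2_separation hp
    refine ⟨TotalSpace.proj ⁻¹' a, TotalSpace.proj ⁻¹' b,
      ha.preimage (FiberBundle.continuous_proj 𝕊² Z.Fiber),
      hb.preimage (FiberBundle.continuous_proj 𝕊² Z.Fiber), hza, hzb, ?_⟩
    exact Set.disjoint_left.2 fun w hw hw' ↦ Set.disjoint_left.1 hab hw hw'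

/-- The total space of the twistor bundle is second countable (`M` is, and it is covered by the
countably many second countable domains `π⁻¹(U)` of local trivialisations). [folklore] -/
instance twistorTotal.instSecondCountableTopology [SecondCountableTopology M] :
    SecondCountableTopology (twistorTotal g hg o) := by
  set Z := twistorCore g hg o with hZ
  obtain ⟨s, hsc, hs⟩ := TopologicalSpace.countable_cover_nhds
    (f := fun y : M ↦ ((twistorFrameAt g hg o y).U : Set M))
    fun y ↦ (twistorFrameAt g hg o y).U.isOpen.mem_nhds (mem_twistorFrameAt g hg o y)
  haveI : ∀ x : s, SecondCountableTopology (Z.localTrivAt (x : M)).source := fun x ↦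
    (Z.localTrivAt (x : M)).toOpenPartialHomeomorph.secondCountableTopology_source
  haveI : Countable s := hsc.to_subtype
  refine TopologicalSpace.secondCountableTopology_of_countable_cover
    (fun x : s ↦ (Z.localTrivAt (x : M)).open_source) ?_
  refine eq_univ_of_forall fun z ↦ ?_
  have hz : z.proj ∈ ⋃ x ∈ s, ((twistorFrameAt g hg o x).U : Set M) := by rw [hs]; trivial
  obtain ⟨x, hx, hzx⟩ := mem_iUnion₂.1 hz
  exact mem_iUnion.2 ⟨⟨x, hx⟩, (Z.mem_localTrivAt_source z x).2 hzx⟩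

/-! ### Smoothness of the transition maps on `M × S²` -/

/-- A continuous map into the sphere which is smooth as an `ℝ³`-valued map on an open set of a
manifold is smooth into the sphere there (`ContMDiff.codRestrict_sphere` on the open submanifold).
[folklore] -/
theorem contMDiffOn_sphere_of_coe {N : Type*} [TopologicalSpace N] {H' : Type*}
    [TopologicalSpace H'] {E' : Type*} [NormedAddCommGroup E'] [NormedSpace ℝ E']
    {J : ModelWithCorners ℝ E' H'} [ChartedSpace H' N] [IsManifold J ∞ N]
    {f : N → 𝕊²} {s : Set N} (hs : IsOpen s)
    (hf : ContMDiffOn J 𝓘(ℝ, E3) ∞ (fun x ↦ (f x : E3)) s) : ContMDiffOn J (𝓡 2) ∞ f s := by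
  intro x hx
  set U : TopologicalSpace.Opens N := ⟨s, hs⟩ with hU
  -- the restriction to the open submanifold `U` is globally smooth into `ℝ³`
  have h1 : ContMDiff J 𝓘(ℝ, E3) ∞ (fun y : U ↦ (f y : E3)) := fun y ↦
    (contMDiffAt_subtype_iff (U := U) (f := fun x ↦ (f x : E3))).2
      ((hf y y.2).contMDiffAt (hs.mem_nhds y.2))
  have h2 : ContMDiff J (𝓡 2) ∞ (Set.codRestrict (fun y : U ↦ (f y : E3)) 𝕊² fun y ↦ (f y).2) :=
    h1.codRestrict_sphere _
  have h3 : (Set.codRestrict (fun y : U ↦ (f y : E3)) 𝕊² fun y ↦ (f y).2) = fun y : U ↦ f y := by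
    funext y; ext1; rfl
  rw [h3] at h2
  have h4 := (contMDiffAt_subtype_iff (U := U) (f := f) (x := ⟨x, hx⟩)).1 (h2 ⟨x, hx⟩)
  exact h4.contMDiffWithinAt

variable {g o} in
/-- **The transition map `(x, ζ) ↦ (x, T(x) ζ)` is a smooth self-map of `(U ∩ U') × S²`** in the
product manifold `M × S²`. [folklore] -/
theorem contMDiffOn_trivChangeMap (F F' : TwistorFrame g o) :
    ContMDiffOn ((𝓡 4).prod (𝓡 2)) ((𝓡 4).prod (𝓡 2)) ∞
      (fun p : M × 𝕊² ↦ ((p.1, twistorCoordChange F F' p.1 p.2) : M × 𝕊²))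
      (((F.U : Set M) ∩ F'.U) ×ˢ (univ : Set 𝕊²)) := by
  have hs : IsOpen (((F.U : Set M) ∩ F'.U) ×ˢ (univ : Set 𝕊²)) :=
    (F.U.isOpen.inter F'.U.isOpen).prod isOpen_univ
  refine contMDiffOn_fst.prodMk (contMDiffOn_sphere_of_coe hs ?_)
  refine (contMDiffOn_twistorCoordChangeVec F F').congr fun p hp ↦ ?_
  exact coe_twistorCoordChange hp.1.1 hp.1.2 p.2

/-! ### The charts: `Z` is modelled on `ℝ⁴ × ℝ²` and on `ℝ⁶` -/

/-- The linear isomorphism `ℝ⁴ × ℝ² ≅ ℝ⁶` (`EuclideanSpace.finAddEquivProd`). [folklore] -/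
def prodEquivSix : (E4 × E2) ≃L[ℝ] E6 :=
  (EuclideanSpace.finAddEquivProd (𝕜 := ℝ) (n := 4) (m := 2)).symm

/-- `ℝ⁴ × ℝ² ≅ ℝ⁶` as a single chart of the model `ModelProd ℝ⁴ ℝ²`. [folklore] -/
def prodChartSix : OpenPartialHomeomorph (ModelProd E4 E2) E6 :=
  (prodEquivSix.toHomeomorph : (E4 × E2) ≃ₜ E6).toOpenPartialHomeomorph

/-- The single chart has source `univ`. [folklore] -/
theorem prodChartSix_source : prodChartSix.source = univ := rfl

/-- `ModelProd ℝ⁴ ℝ²` charted on `ℝ⁶` by the single chart `prodChartSix`. [folklore] -/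
instance instChartedSpaceModelProdSix : ChartedSpace E6 (ModelProd E4 E2) :=
  prodChartSix.singletonChartedSpace prodChartSix_source

/-- The total space charted on `ℝ⁴ × ℝ²`: local trivialisation, then a chart of `M × S²`.
[folklore] -/
instance twistorTotal.instChartedSpaceProd : ChartedSpace (ModelProd E4 E2) (twistorTotal g hg o) :=
  ChartedSpace.comp (ModelProd E4 E2) (M × 𝕊²) (twistorTotal g hg o)

/-- **The total space of the twistor bundle charted on `ℝ⁶`.** [cite: AtiyahHitchinSinger1978, §4] -/
instance twistorTotal.instChartedSpace : ChartedSpace E6 (twistorTotal g hg o) :=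
  ChartedSpace.comp E6 (ModelProd E4 E2) (twistorTotal g hg o)

/-- The charts of the `ℝ⁴ × ℝ²`-atlas of `Z`: `(localTriv F) ≫ (cM × cS)` for a twistor frame
`F` and charts `cM`, `cS` of `M` and `S²`. [folklore] -/
theorem twistorTotal.mem_atlas_prod_iff (e : OpenPartialHomeomorph (twistorTotal g hg o) (ModelProd E4 E2)) :
    e ∈ atlas (ModelProd E4 E2) (twistorTotal g hg o) ↔
      ∃ F : TwistorFrame g o, ∃ cM ∈ atlas E4 M, ∃ cS ∈ atlas E2 𝕊²,
        e = ((twistorCore g hg o).localTriv F).toOpenPartialHomeomorph ≫ₕ (cM.prod cS) := by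
  constructor
  · rintro ⟨eZ, ⟨T, ⟨F, rfl⟩, rfl⟩, eMS, ⟨cM, hcM, cS, hcS, rfl⟩, rfl⟩
    exact ⟨F, cM, hcM, cS, hcS, rfl⟩
  · rintro ⟨F, cM, hcM, cS, hcS, rfl⟩
    exact ⟨_, ⟨_, ⟨F, rfl⟩, rfl⟩, _, ⟨cM, hcM, cS, hcS, rfl⟩, rfl⟩

/-- The charts of the `ℝ⁶`-atlas of `Z` are the charts of the `ℝ⁴ × ℝ²`-atlas followed by
`prodChartSix`. [folklore] -/
theorem twistorTotal.mem_atlas_iff (e : OpenPartialHomeomorph (twistorTotal g hg o) E6) :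
    e ∈ atlas E6 (twistorTotal g hg o) ↔
      ∃ e' ∈ atlas (ModelProd E4 E2) (twistorTotal g hg o), e = e' ≫ₕ prodChartSix := by
  constructor
  · rintro ⟨e', he', c, hc, rfl⟩
    have hc' : c = prodChartSix := hc
    exact ⟨e', he', by rw [hc']⟩
  · rintro ⟨e', he', rfl⟩
    exact ⟨e', he', prodChartSix, rfl, rfl⟩

/-- `prodChartSix` is `prodEquivSix` on points. [folklore] -/
@[simp] theorem prodChartSix_apply (p : E4 × E2) : prodChartSix p = prodEquivSix p := rfl

/-- The inverse of `prodChartSix` is `prodEquivSix.symm` on points. [folklore] -/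
@[simp] theorem prodChartSix_symm_apply (q : E6) : prodChartSix.symm q = prodEquivSix.symm q := rfl

/-- The single chart has target `univ`. [folklore] -/
@[simp] theorem prodChartSix_target : prodChartSix.target = univ := rfl

/-- `T_{F₂} ∘ T_{F₁}⁻¹` is the transition map `(x, ζ) ↦ (x, T(x) ζ)` over `U₁ ∩ U₂`. [folklore] -/
theorem twistorCore_localTriv_symm_trans (F₁ F₂ : TwistorFrame g o) (p : M × 𝕊²)
    (h₁ : p.1 ∈ F₁.U) (h₂ : p.1 ∈ F₂.U) :
    ((twistorCore g hg o).localTriv F₂) (((twistorCore g hg o).localTriv F₁).toOpenPartialHomeomorph.symm p) =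
      (p.1, twistorCoordChange F₁ F₂ p.1 p.2) := by
  rw [FiberBundleCore.localTriv_symm_apply, FiberBundleCore.localTriv_apply]
  congr 1
  exact (twistorCore g hg o).coordChange_comp F₁ ((twistorCore g hg o).indexAt p.1) F₂ p.1
    ⟨⟨h₁, (twistorCore g hg o).mem_baseSet_at p.1⟩, h₂⟩ p.2

/-- **The chart changes of `Z` are smooth**: for two charts `eᵢ = (localTriv Fᵢ) ≫ (cMᵢ × cSᵢ) ≫ L`
of the `ℝ⁶`-atlas, `e₂ ∘ e₁⁻¹ = L ∘ (cM₂ × cS₂) ∘ Θ ∘ (cM₁ × cS₁)⁻¹ ∘ L⁻¹` with the smooth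
transition map `Θ(x, ζ) = (x, T(x) ζ)` of `M × S²` (`contMDiffOn_trivChangeMap`), read in charts of
the product manifold. [folklore] -/
theorem twistorTotal.contDiffOn_transition
    (e₁ e₂ : OpenPartialHomeomorph (twistorTotal g hg o) (ModelProd E4 E2))
    (h₁ : e₁ ∈ atlas (ModelProd E4 E2) (twistorTotal g hg o))
    (h₂ : e₂ ∈ atlas (ModelProd E4 E2) (twistorTotal g hg o)) :
    ContDiffOn ℝ ∞ (⇑((e₁ ≫ₕ prodChartSix).symm ≫ₕ (e₂ ≫ₕ prodChartSix)))
      ((e₁ ≫ₕ prodChartSix).symm ≫ₕ (e₂ ≫ₕ prodChartSix)).source := by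
  obtain ⟨F₁, cM₁, hcM₁, cS₁, hcS₁, rfl⟩ := (twistorTotal.mem_atlas_prod_iff g hg o e₁).1 h₁
  obtain ⟨F₂, cM₂, hcM₂, cS₂, hcS₂, rfl⟩ := (twistorTotal.mem_atlas_prod_iff g hg o e₂).1 h₂
  have hc₁A : cM₁.prod cS₁ ∈ IsManifold.maximalAtlas ((𝓡 4).prod (𝓡 2)) ∞ (M × 𝕊²) :=
    IsManifold.subset_maximalAtlas ⟨cM₁, hcM₁, cS₁, hcS₁, rfl⟩
  have hc₂A : cM₂.prod cS₂ ∈ IsManifold.maximalAtlas ((𝓡 4).prod (𝓡 2)) ∞ (M × 𝕊²) :=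
    IsManifold.subset_maximalAtlas ⟨cM₂, hcM₂, cS₂, hcS₂, rfl⟩
  set Θ : M × 𝕊² → M × 𝕊² := fun p ↦ (p.1, twistorCoordChange F₁ F₂ p.1 p.2) with hΘ
  have hopen : IsOpen (((((twistorCore g hg o).localTriv F₁).toOpenPartialHomeomorph ≫ₕ
      cM₁.prod cS₁) ≫ₕ prodChartSix).symm ≫ₕ
      ((((twistorCore g hg o).localTriv F₂).toOpenPartialHomeomorph ≫ₕ cM₂.prod cS₂) ≫ₕ
        prodChartSix)).source := OpenPartialHomeomorph.open_source _
  -- membership facts of a point of the source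
  have hmem : ∀ q, q ∈ (((((twistorCore g hg o).localTriv F₁).toOpenPartialHomeomorph ≫ₕ
      cM₁.prod cS₁) ≫ₕ prodChartSix).symm ≫ₕ
      ((((twistorCore g hg o).localTriv F₂).toOpenPartialHomeomorph ≫ₕ cM₂.prod cS₂) ≫ₕ
        prodChartSix)).source →
      prodEquivSix.symm q ∈ (cM₁.prod cS₁).target ∧
        ((cM₁.prod cS₁).symm (prodEquivSix.symm q)).1 ∈ F₁.U ∧
        ((cM₁.prod cS₁).symm (prodEquivSix.symm q)).1 ∈ F₂.U ∧
        Θ ((cM₁.prod cS₁).symm (prodEquivSix.symm q)) ∈ (cM₂.prod cS₂).source := by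
    intro q hq
    rw [OpenPartialHomeomorph.trans_source, OpenPartialHomeomorph.symm_source, mem_inter_iff,
      mem_preimage, OpenPartialHomeomorph.trans_target, mem_inter_iff, mem_preimage,
      OpenPartialHomeomorph.trans_target, mem_inter_iff, mem_preimage] at hq
    obtain ⟨⟨-, hq1, hq2⟩, hq34⟩ := hq
    rw [OpenPartialHomeomorph.coe_trans_symm, OpenPartialHomeomorph.coe_trans_symm,
      Function.comp_apply, Function.comp_apply, OpenPartialHomeomorph.trans_source, mem_inter_iff,
      mem_preimage, OpenPartialHomeomorph.trans_source, mem_inter_iff, mem_preimage] at hq34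
    obtain ⟨⟨hq3, hq4⟩, -⟩ := hq34
    have hq2' : ((cM₁.prod cS₁).symm (prodEquivSix.symm q)).1 ∈ F₁.U :=
      ((twistorCore g hg o).mem_localTriv_target F₁ _).1 hq2
    have hx₂ : ((cM₁.prod cS₁).symm (prodEquivSix.symm q)).1 ∈ F₂.U :=
      ((twistorCore g hg o).mem_localTriv_source F₂ _).1 hq3
    refine ⟨hq1, hq2', hx₂, ?_⟩
    have key := twistorCore_localTriv_symm_trans g hg o F₁ F₂
      ((cM₁.prod cS₁).symm (prodEquivSix.symm q)) hq2' hx₂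
    exact (congrArg (· ∈ (cM₂.prod cS₂).source) key).mp hq4
  intro q hq
  refine ContDiffAt.contDiffWithinAt ?_
  obtain ⟨hq1, hx₁, hx₂, hΘc2⟩ := hmem q hq
  have hp1 : (cM₁.prod cS₁).symm (prodEquivSix.symm q) ∈ (cM₁.prod cS₁).source :=
    (cM₁.prod cS₁).map_target hq1
  -- smoothness of `Θ` at the point, read in the charts
  have hΘs : ContMDiffAt ((𝓡 4).prod (𝓡 2)) ((𝓡 4).prod (𝓡 2)) ∞ Θ
      ((cM₁.prod cS₁).symm (prodEquivSix.symm q)) :=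
    (contMDiffOn_trivChangeMap F₁ F₂ _ ⟨⟨hx₁, hx₂⟩, mem_univ _⟩).contMDiffAt
      (((F₁.U.isOpen.inter F₂.U.isOpen).prod isOpen_univ).mem_nhds ⟨⟨hx₁, hx₂⟩, mem_univ _⟩)
  have hread' := ((contMDiffWithinAt_iff_of_mem_maximalAtlas (s := univ) hc₁A hc₂A hp1 hΘc2).1
    hΘs.contMDiffWithinAt).2
  have hread := hread'.contDiffAt (by
    rw [ModelWithCorners.range_eq_univ, preimage_univ, univ_inter]; exact univ_mem)
  have hcp : prodEquivSix.symm q =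
      (cM₁.prod cS₁).extend ((𝓡 4).prod (𝓡 2)) ((cM₁.prod cS₁).symm (prodEquivSix.symm q)) := by
    rw [OpenPartialHomeomorph.extend_coe, Function.comp_apply, (cM₁.prod cS₁).right_inv hq1]
    rfl
  have hread2 : ContDiffAt ℝ ∞ ((cM₂.prod cS₂).extend ((𝓡 4).prod (𝓡 2)) ∘ Θ ∘
      ((cM₁.prod cS₁).extend ((𝓡 4).prod (𝓡 2))).symm) (prodEquivSix.symm q) := hcp ▸ hread
  have hcomp : ContDiffAt ℝ ∞ (⇑prodEquivSix ∘ (((cM₂.prod cS₂).extend ((𝓡 4).prod (𝓡 2)) ∘ Θ ∘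
      ((cM₁.prod cS₁).extend ((𝓡 4).prod (𝓡 2))).symm) ∘ ⇑prodEquivSix.symm)) q :=
    prodEquivSix.contDiff.contDiffAt.comp q
      (hread2.comp q prodEquivSix.symm.contDiff.contDiffAt)
  -- identify with the transition map near `q`
  refine hcomp.congr_of_eventuallyEq ?_
  filter_upwards [hopen.mem_nhds hq] with q' hq'
  obtain ⟨-, hx₁', hx₂', -⟩ := hmem q' hq'
  have key := twistorCore_localTriv_symm_trans g hg o F₁ F₂
    ((cM₁.prod cS₁).symm (prodEquivSix.symm q')) hx₁' hx₂'
  exact congrArg (fun r ↦ prodEquivSix ((cM₂.prod cS₂) r)) key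

/-- **The twistor bundle is a `C^∞` manifold modelled on `ℝ⁶`.** [cite: AtiyahHitchinSinger1978, §4] -/
instance twistorTotal.instIsManifold : IsManifold (𝓡 6) ∞ (twistorTotal g hg o) := by
  refine isManifold_of_contDiffOn (𝓡 6) ∞ (twistorTotal g hg o) fun e e' he he' ↦ ?_
  obtain ⟨e₁, h₁, rfl⟩ := (twistorTotal.mem_atlas_iff g hg o e).1 he
  obtain ⟨e₂, h₂, rfl⟩ := (twistorTotal.mem_atlas_iff g hg o e').1 he'
  have key := twistorTotal.contDiffOn_transition g hg o e₁ e₂ h₁ h₂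
  simpa only [modelWithCornersSelf_coe, modelWithCornersSelf_coe_symm, Function.comp_id,
    Function.id_comp, range_id, inter_univ, preimage_id_eq, id_eq] using key

end Literature.Geometry.Riemannian
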